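import Summits.MatrixMultiplication.OmegaCensus.DominoZ7Z7Cells
import Summits.MatrixMultiplication.OmegaCensus.ThreeSetZ4Z4Cells
import Summits.MatrixMultiplication.OmegaCensus.DihedralLawModOneOrder25
import HarnessLib

/-!
# The `|A| ≡ 1 (mod 3)` law at `|A| = 49`: no law over `ℤ_7 × ℤ_7` (order `49` as one kernel theorem)

ω-census `pub-omega`, family (b3), seat pub-omega-group gen 38.  Framing: lottery ticket; floor = certified bounds/negative ranges.
VALUE: ONE kernel theorem for the census line `|A| = 49` of the classification of dihedral-like groups attaining the law
`3|S||T||U| + 8 = 8|A|` ('law ⟹ an element of order `≥ |A|/2`'; `ℤ_7²` is the only non-cyclic abelian group of order `49`) — assembled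
from existing kernel cells, no new computation; NOT progress on ω.

Proof of **`no_mod_one_law_z7_z7`** (same assembly as `DihedralLawModOneOrder325.no_mod_one_law_z5_z65`).  Every element of `ℤ_7²` has order
`≤ 7 < |A|/2`, so `A` is not two cosets of a cyclic subgroup (`two_cosets_of_mod_one_law_of_not_cube`: the parts are cube,
`(s,s | t,t | u,u)` with `3stu + 1 = 49`, `stu = 16` — `cube_factor_of_49`, `15` ordered factorisations); two parts `1`
(`card_le_two_mul_addOrderOf_of_two_two_law`) or a part `2` (`card_le_two_mul_addOrderOf_of_mod_one_law_card_four`) again give an element of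
order `≥ |A|/2`; the remaining shapes are the census cells `(1,4,4)` (`no_law_cube_14e_of_onto_z7z7`) in all orderings
(`no_law_cube_two_parts_of_ordered`).
-/

namespace Summit.MatrixMultiplication.OmegaCensus

open Literature.Combinatorics.Additive Finset

/-! ## Arithmetic: the ordered factorisations of `16` -/

section Arith

/-- The cube part sizes at `|A| = 49`: `cde = 16`, all `15` ordered factorisations. [folklore] -/
theorem cube_factor_of_49 {c d e : ℕ} (h : 3 * (c * d * e) + 1 = 49) :
    (c = 1 ∧ d = 1 ∧ e = 16) ∨
      (c = 1 ∧ d = 2 ∧ e = 8) ∨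
      (c = 1 ∧ d = 4 ∧ e = 4) ∨
      (c = 1 ∧ d = 8 ∧ e = 2) ∨
      (c = 1 ∧ d = 16 ∧ e = 1) ∨
      (c = 2 ∧ d = 1 ∧ e = 8) ∨
      (c = 2 ∧ d = 2 ∧ e = 4) ∨
      (c = 2 ∧ d = 4 ∧ e = 2) ∨
      (c = 2 ∧ d = 8 ∧ e = 1) ∨
      (c = 4 ∧ d = 1 ∧ e = 4) ∨
      (c = 4 ∧ d = 2 ∧ e = 2) ∨
      (c = 4 ∧ d = 4 ∧ e = 1) ∨
      (c = 8 ∧ d = 1 ∧ e = 2) ∨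
      (c = 8 ∧ d = 2 ∧ e = 1) ∨
      (c = 16 ∧ d = 1 ∧ e = 1) := by
  have hcde : c * (d * e) = 16 := by rw [← mul_assoc]; omega
  have hc : c ∈ Nat.divisors 16 := Nat.mem_divisors.2 ⟨Dvd.intro _ hcde, by norm_num⟩
  have hd : d ∈ Nat.divisors 16 :=
    Nat.mem_divisors.2 ⟨Dvd.intro (c * e) (by rw [← hcde]; ring), by norm_num⟩
  rw [show Nat.divisors 16 = {1, 2, 4, 8, 16} from by decide] at hc hd
  simp only [Finset.mem_insert, Finset.mem_singleton] at hc hd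
  rcases hc with rfl | rfl | rfl | rfl | rfl <;> rcases hd with rfl | rfl | rfl | rfl | rfl
  · have he : e = 16 := by omega
    exact Or.inl ⟨rfl, rfl, he⟩
  · have he : e = 8 := by omega
    exact Or.inr (Or.inl ⟨rfl, rfl, he⟩)
  · have he : e = 4 := by omega
    exact Or.inr (Or.inr (Or.inl ⟨rfl, rfl, he⟩))
  · have he : e = 2 := by omega
    exact Or.inr (Or.inr (Or.inr (Or.inl ⟨rfl, rfl, he⟩)))
  · have he : e = 1 := by omega
    exact Or.inr (Or.inr (Or.inr (Or.inr (Or.inl ⟨rfl, rfl, he⟩))))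
  · have he : e = 8 := by omega
    exact Or.inr (Or.inr (Or.inr (Or.inr (Or.inr (Or.inl ⟨rfl, rfl, he⟩)))))
  · have he : e = 4 := by omega
    exact Or.inr (Or.inr (Or.inr (Or.inr (Or.inr (Or.inr (Or.inl ⟨rfl, rfl, he⟩))))))
  · have he : e = 2 := by omega
    exact Or.inr (Or.inr (Or.inr (Or.inr (Or.inr (Or.inr (Or.inr (Or.inl ⟨rfl, rfl, he⟩)))))))
  · have he : e = 1 := by omega
    exact Or.inr (Or.inr (Or.inr (Or.inr (Or.inr (Or.inr (Or.inr (Or.inr (Or.inl ⟨rfl, rfl, he⟩))))))))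
  · omega
  · have he : e = 4 := by omega
    exact Or.inr (Or.inr (Or.inr (Or.inr (Or.inr (Or.inr (Or.inr (Or.inr (Or.inr (Or.inl ⟨rfl, rfl, he⟩)))))))))
  · have he : e = 2 := by omega
    exact Or.inr (Or.inr (Or.inr (Or.inr (Or.inr (Or.inr (Or.inr (Or.inr (Or.inr (Or.inr (Or.inl ⟨rfl, rfl, he⟩))))))))))
  · have he : e = 1 := by omega
    exact Or.inr (Or.inr (Or.inr (Or.inr (Or.inr (Or.inr (Or.inr (Or.inr (Or.inr (Or.inr (Or.inr (Or.inl ⟨rfl, rfl, he⟩)))))))))))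
  · omega
  · omega
  · have he : e = 2 := by omega
    exact Or.inr (Or.inr (Or.inr (Or.inr (Or.inr (Or.inr (Or.inr (Or.inr (Or.inr (Or.inr (Or.inr (Or.inr (Or.inl ⟨rfl, rfl, he⟩))))))))))))
  · have he : e = 1 := by omega
    exact Or.inr (Or.inr (Or.inr (Or.inr (Or.inr (Or.inr (Or.inr (Or.inr (Or.inr (Or.inr (Or.inr (Or.inr (Or.inr (Or.inl ⟨rfl, rfl, he⟩)))))))))))))
  · omega
  · omega
  · omega
  · have he : e = 1 := by omega
    exact Or.inr (Or.inr (Or.inr (Or.inr (Or.inr (Or.inr (Or.inr (Or.inr (Or.inr (Or.inr (Or.inr (Or.inr (Or.inr (Or.inr (⟨rfl, rfl, he⟩))))))))))))))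
  · omega
  · omega
  · omega
  · omega

end Arith

/-! ## Assembly -/

section DihedralLike

variable {G : Type} [Group G] [DecidableEq G] {S T U : Finset G}

/-- **ORDER 49: no dihedral-like group over `ℤ_7 × ℤ_7` (any presentation constant `c₀`; for `c₀ = 0` this is `Dih(ℤ_7²)`) has a TPP
triple attaining the law `3|S||T||U| + 8 = 8|A|`.** [folklore] -/
theorem no_mod_one_law_z7_z7 {ρ τ : ZMod 7 × ZMod 7 → G} {c₀ : ZMod 7 × ZMod 7}
    (hρρ : ∀ a b, ρ a * ρ b = ρ (a + b)) (hρτ : ∀ a b, ρ a * τ b = τ (b - a))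
    (hτρ : ∀ a b, τ a * ρ b = τ (a + b)) (hττ : ∀ a b, τ a * τ b = ρ (c₀ + b - a))
    (hρ : Function.Injective ρ) (hτ : Function.Injective τ) (hne : ∀ a b, ρ a ≠ τ b)
    (hsurj : ∀ g, (∃ a, ρ a = g) ∨ (∃ a, τ a = g)) (h : TripleProductProperty S T U) :
    3 * (S.card * T.card * U.card) + 8 ≠ 8 * Fintype.card (ZMod 7 × ZMod 7) := by
  intro hV
  have hA : Fintype.card (ZMod 7 × ZMod 7) = 49 := by rw [Fintype.card_prod, ZMod.card]
  have hp : ∀ q : ZMod 7 × ZMod 7, 7 • q = 0 := by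
    intro q
    refine Prod.ext ?_ ?_
    · show 7 • q.1 = 0
      rw [nsmul_eq_mul, show ((7 : ℕ) : ZMod 7) = 0 from by decide, zero_mul]
    · show 7 • q.2 = 0
      rw [nsmul_eq_mul, show ((7 : ℕ) : ZMod 7) = 0 from by decide, zero_mul]
  have big : ¬ ∃ g : ZMod 7 × ZMod 7, Fintype.card (ZMod 7 × ZMod 7) ≤ 2 * addOrderOf g := by
    rintro ⟨g, hg⟩
    have hle : addOrderOf g ≤ 7 := Nat.le_of_dvd (by norm_num) (addOrderOf_dvd_of_nsmul_eq_zero (hp g))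
    rw [hA] at hg
    omega
  have hmod : Fintype.card (ZMod 7 × ZMod 7) % 3 = 1 := by rw [hA]
  have hA14 : 14 ≤ Fintype.card (ZMod 7 × ZMod 7) := by rw [hA]; norm_num
  have hA7 : 7 ≤ Fintype.card (ZMod 7 × ZMod 7) := by omega
  have hV_TUS : 3 * (T.card * U.card * S.card) + 8 = 8 * Fintype.card (ZMod 7 × ZMod 7) := by
    rw [show T.card * U.card * S.card = S.card * T.card * U.card by ring]; exact hV
  have hV_UST : 3 * (U.card * S.card * T.card) + 8 = 8 * Fintype.card (ZMod 7 × ZMod 7) := by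
    rw [show U.card * S.card * T.card = S.card * T.card * U.card by ring]; exact hV
  have hTUS : TripleProductProperty T U S := h.rotate
  have hUST : TripleProductProperty U S T := h.rotate.rotate
  by_cases hnc : ((univ.filter fun a : ZMod 7 × ZMod 7 => ρ a ∈ S).card = (univ.filter fun a : ZMod 7 × ZMod 7 => τ a ∈ S).card ∧
      (univ.filter fun a : ZMod 7 × ZMod 7 => ρ a ∈ T).card = (univ.filter fun a : ZMod 7 × ZMod 7 => τ a ∈ T).card ∧
      (univ.filter fun a : ZMod 7 × ZMod 7 => ρ a ∈ U).card = (univ.filter fun a : ZMod 7 × ZMod 7 => τ a ∈ U).card)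
  · obtain ⟨hS', hT', hU'⟩ := hnc
    have cS := card_eq_parts' hρ hτ hne hsurj S
    have cT := card_eq_parts' hρ hτ hne hsurj T
    have cU := card_eq_parts' hρ hτ hne hsurj U
    set s₀ := (univ.filter fun a : ZMod 7 × ZMod 7 => ρ a ∈ S).card with hs₀
    set t₀ := (univ.filter fun a : ZMod 7 × ZMod 7 => ρ a ∈ T).card with ht₀
    set u₀ := (univ.filter fun a : ZMod 7 × ZMod 7 => ρ a ∈ U).card with hu₀
    have eS : S.card = 2 * s₀ := by rw [cS, ← hS']; ring
    have eT : T.card = 2 * t₀ := by rw [cT, ← hT']; ring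
    have eU : U.card = 2 * u₀ := by rw [cU, ← hU']; ring
    have hprod : 3 * (s₀ * t₀ * u₀) + 1 = 49 := by
      rw [eS, eT, eU, hA] at hV; nlinarith
    rcases cube_factor_of_49 hprod with ⟨h1, h2, h3⟩ | ⟨h1, h2, h3⟩ | ⟨h1, h2, h3⟩ | ⟨h1, h2, h3⟩ | ⟨h1, h2, h3⟩ | ⟨h1, h2, h3⟩ | ⟨h1, h2, h3⟩ | ⟨h1, h2, h3⟩ | ⟨h1, h2, h3⟩ | ⟨h1, h2, h3⟩ | ⟨h1, h2, h3⟩ | ⟨h1, h2, h3⟩ | ⟨h1, h2, h3⟩ | ⟨h1, h2, h3⟩ | ⟨h1, h2, h3⟩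
    · -- (1,1,16)
      exact big (card_le_two_mul_addOrderOf_of_two_two_law hρρ hρτ hτρ hττ hρ hτ hne hsurj hmod hA7 h (by rw [eS, h1]) (by rw [eT, h2]) hV)
    · -- (1,2,8)
      exact big (card_le_two_mul_addOrderOf_of_mod_one_law_card_four hρρ hρτ hτρ hττ hρ hτ hne hsurj hmod hA14 h hV (by rw [eT, h2]))
    · -- (1,4,4)
      exact absurd hV (no_law_cube_two_parts_of_ordered 1 4 (fun h' hS₀ hS₁ hT₀ hT₁ hU'' hV'' => no_law_cube_14e_of_onto_z7z7 hρρ hρτ hτρ hττ hρ hτ hne hsurj (AddMonoidHom.id (ZMod 7 × ZMod 7)) Function.surjective_id h' hS₀ hS₁ hT₀ hT₁ hU'' hV'') h hS' hT' hU'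
        (Or.inl ⟨h1, h2⟩))
    · -- (1,8,2)
      exact big (card_le_two_mul_addOrderOf_of_mod_one_law_card_four hρρ hρτ hτρ hττ hρ hτ hne hsurj hmod hA14 hTUS hV_TUS (by rw [eU, h3]))
    · -- (1,16,1)
      exact big (card_le_two_mul_addOrderOf_of_two_two_law hρρ hρτ hτρ hττ hρ hτ hne hsurj hmod hA7 hUST (by rw [eU, h3]) (by rw [eS, h1]) hV_UST)
    · -- (2,1,8)
      exact big (card_le_two_mul_addOrderOf_of_mod_one_law_card_four hρρ hρτ hτρ hττ hρ hτ hne hsurj hmod hA14 hUST hV_UST (by rw [eS, h1]))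
    · -- (2,2,4)
      exact big (card_le_two_mul_addOrderOf_of_mod_one_law_card_four hρρ hρτ hτρ hττ hρ hτ hne hsurj hmod hA14 h hV (by rw [eT, h2]))
    · -- (2,4,2)
      exact big (card_le_two_mul_addOrderOf_of_mod_one_law_card_four hρρ hρτ hτρ hττ hρ hτ hne hsurj hmod hA14 hUST hV_UST (by rw [eS, h1]))
    · -- (2,8,1)
      exact big (card_le_two_mul_addOrderOf_of_mod_one_law_card_four hρρ hρτ hτρ hττ hρ hτ hne hsurj hmod hA14 hUST hV_UST (by rw [eS, h1]))
    · -- (4,1,4)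
      exact absurd hV (no_law_cube_two_parts_of_ordered 1 4 (fun h' hS₀ hS₁ hT₀ hT₁ hU'' hV'' => no_law_cube_14e_of_onto_z7z7 hρρ hρτ hτρ hττ hρ hτ hne hsurj (AddMonoidHom.id (ZMod 7 × ZMod 7)) Function.surjective_id h' hS₀ hS₁ hT₀ hT₁ hU'' hV'') h hS' hT' hU'
        (Or.inr (Or.inl ⟨h2, h3⟩)))
    · -- (4,2,2)
      exact big (card_le_two_mul_addOrderOf_of_mod_one_law_card_four hρρ hρτ hτρ hττ hρ hτ hne hsurj hmod hA14 h hV (by rw [eT, h2]))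
    · -- (4,4,1)
      exact absurd hV (no_law_cube_two_parts_of_ordered 1 4 (fun h' hS₀ hS₁ hT₀ hT₁ hU'' hV'' => no_law_cube_14e_of_onto_z7z7 hρρ hρτ hτρ hττ hρ hτ hne hsurj (AddMonoidHom.id (ZMod 7 × ZMod 7)) Function.surjective_id h' hS₀ hS₁ hT₀ hT₁ hU'' hV'') h hS' hT' hU'
        (Or.inr (Or.inr (Or.inl ⟨h3, h1⟩))))
    · -- (8,1,2)
      exact big (card_le_two_mul_addOrderOf_of_mod_one_law_card_four hρρ hρτ hτρ hττ hρ hτ hne hsurj hmod hA14 hTUS hV_TUS (by rw [eU, h3]))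
    · -- (8,2,1)
      exact big (card_le_two_mul_addOrderOf_of_mod_one_law_card_four hρρ hρτ hτρ hττ hρ hτ hne hsurj hmod hA14 h hV (by rw [eT, h2]))
    · -- (16,1,1)
      exact big (card_le_two_mul_addOrderOf_of_two_two_law hρρ hρτ hτρ hττ hρ hτ hne hsurj hmod hA7 hTUS (by rw [eT, h2]) (by rw [eU, h3]) hV_TUS)
  · obtain ⟨g, a, b, hab⟩ :=
      two_cosets_of_mod_one_law_of_not_cube hρρ hρτ hτρ hττ hρ hτ hne hsurj hmod hA14 h hV hnc
    exact big ⟨g, card_le_two_mul_addOrderOf_of_two_cosets hab⟩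

end DihedralLike

end Summit.MatrixMultiplication.OmegaCensus
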